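import Literature.Analysis.OperatorTheory.RealIntertwineCFC
import Literature.Analysis.OperatorTheory.AntiunitaryFromGenerators
import Mathlib.Analysis.InnerProductSpace.Projection.Submodule
import Mathlib.Analysis.InnerProductSpace.Positive
import Mathlib.Analysis.InnerProductSpace.StarOrder
import Mathlib.Analysis.CStarAlgebra.ContinuousFunctionalCalculus.Order
import HarnessLib

/-!
# Standard real subspaces of a complex Hilbert space: the operators `R`, `T`, `J`
# (Rieffel–van Daele's bounded approach to Tomita–Takesaki theory, §§2–3)

Let `H` be a complex Hilbert space, viewed also as a real Hilbert space through
`⟪x, y⟫_ℝ = Re ⟪x, y⟫`, and let `K` be a closed real subspace. Rieffel–van Daele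
(*A bounded operator approach to Tomita–Takesaki theory*, Pacific J. Math. 69 (1977), §2
Definition 2.1, Proposition 2.2, §3 Proposition 3.1) attach to the pair `(K, iK)` the real
orthogonal projections `P` (onto `K`) and `Q` (onto `iK`), the operators

* `R = P + Q` — complex linear, self-adjoint, `0 ≤ R ≤ 2`, with `R` and `2 − R` injective when
  `K ∩ iK = 0` and `K + iK` is dense (Prop. 2.2 (1), Prop. 3.1);
* `P − Q` — conjugate linear, with `(P − Q)² = R(2 − R)` (proof of Prop. 2.2 (2));
* `T = (R(2 − R))^{1/2} = |P − Q|` — complex linear, positive, injective, commuting with `P`, `Q`,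
  `R` (Prop. 2.2 (2), (4));
* `J` — the phase of the polar decomposition `P − Q = J T`: a conjugate-linear isometric
  involution ("`J` is a conjugate linear isometry, so that `⟨Jξ, η⟩ = ⟨Jη, ξ⟩`", Prop. 3.1) with
  `J T = T J`, `J P = (1 − Q) J`, `J Q = (1 − P) J`, `J R = (2 − R) J` (Prop. 2.2 (3)–(5)).

These are exactly the data from which the modular group `Δ^{it} = (2 − R)^{it} R^{−it}` and the
modular conjugation `J` of Tomita–Takesaki theory are built (op. cit. §§3–4); here we construct
them with Mathlib's real orthogonal projections, the continuous functional calculus (for `T`), and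
the antiunitary extension theorem `exists_antiunitary_extending` (for `J`, defined on the dense
range of `T` by `J (T ξ) = (P − Q) ξ`).

## Main definitions

* `realIPS` — the real Hilbert space structure `Re ⟪·,·⟫` (local instance).
* `rotI`, `mulI K` — multiplication by `i` as a real isometry, and the real subspace `iK`.
* `modR K`, `modB K`, `modTsq K`, `modT K`, `modJ K hsep hdense`.

## References
* M. A. Rieffel, A. van Daele, *A bounded operator approach to Tomita–Takesaki theory*, Pacific
  J. Math. 69 (1977) 187–221, Def. 2.1, Prop. 2.2, Prop. 3.1. [RieffelVandaele1977]
-/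

noncomputable section

open Complex ContinuousLinearMap
open scoped InnerProductSpace ComplexConjugate

set_option synthInstance.maxHeartbeats 200000

namespace Literature.Analysis.OperatorTheory

variable {H : Type*} [NormedAddCommGroup H] [InnerProductSpace ℂ H] [CompleteSpace H]

/-! ### The real Hilbert space structure -/

/-- The real Hilbert space underlying a complex one: `⟪x, y⟫_ℝ = Re ⟪x, y⟫` (Rieffel–van Daele
§3: "we view `ℋ` as a real Hilbert space by equipping it with the real part of its
inner-product"). A local instance in this development. [cite: RieffelVandaele1977, §3 (p. 193)] -/
@[reducible] def realIPS : InnerProductSpace ℝ H := InnerProductSpace.complexToReal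

attribute [local instance] realIPS

omit [CompleteSpace H] in
/-- `⟪x, y⟫_ℝ = Re ⟪x, y⟫`. [cite: RieffelVandaele1977, §3 (p. 193)] -/
theorem real_inner_eq_re (x y : H) : ⟪x, y⟫_ℝ = (⟪x, y⟫_ℂ).re := rfl

omit [CompleteSpace H] in
/-- `Re ⟪x, i y⟫ = -Im ⟪x, y⟫`. [folklore] -/
theorem re_inner_I_smul_right (x y : H) : (⟪x, (I : ℂ) • y⟫_ℂ).re = -(⟪x, y⟫_ℂ).im := by
  rw [inner_smul_right]; simp

omit [CompleteSpace H] in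
/-- `Im ⟪x, y⟫ = -Re ⟪x, i y⟫`. [folklore] -/
theorem im_inner_eq_neg_re_inner_I_smul (x y : H) : (⟪x, y⟫_ℂ).im = -(⟪x, (I : ℂ) • y⟫_ℂ).re := by
  rw [re_inner_I_smul_right, neg_neg]

omit [CompleteSpace H] in
/-- `⟪i x, i y⟫ = ⟪x, y⟫`. [folklore] -/
theorem inner_I_smul_I_smul (x y : H) : ⟪(I : ℂ) • x, (I : ℂ) • y⟫_ℂ = ⟪x, y⟫_ℂ := by
  rw [inner_smul_left, inner_smul_right]; simp [← mul_assoc]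

omit [CompleteSpace H] in
/-- A complex scalar acts through its real and imaginary parts. [folklore] -/
theorem complex_smul_eq (c : ℂ) (x : H) : c • x = c.re • x + c.im • ((I : ℂ) • x) := by
  conv_lhs => rw [← re_add_im c]
  rw [add_smul, mul_smul, Complex.coe_smul, Complex.coe_smul]

omit [CompleteSpace H] in
/-- Two vectors with the same real inner products against everything are equal. [folklore] -/
theorem ext_real_inner {x y : H} (h : ∀ v, (⟪x, v⟫_ℂ).re = (⟪y, v⟫_ℂ).re) : x = y := by
  refine ext_inner_right ℂ fun v => ?_
  apply Complex.ext
  · exact h v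
  · rw [im_inner_eq_neg_re_inner_I_smul, im_inner_eq_neg_re_inner_I_smul, h]

/-- A complex-linear operator which is symmetric for the real inner product is self-adjoint.
[folklore] -/
theorem isSelfAdjoint_of_re_inner_symm (R : H →L[ℂ] H)
    (h : ∀ x y, (⟪R x, y⟫_ℂ).re = (⟪x, R y⟫_ℂ).re) : IsSelfAdjoint R := by
  rw [ContinuousLinearMap.isSelfAdjoint_iff_isSymmetric]
  intro x y
  change ⟪R x, y⟫_ℂ = ⟪x, R y⟫_ℂ
  apply Complex.ext
  · exact h x y
  · rw [im_inner_eq_neg_re_inner_I_smul, im_inner_eq_neg_re_inner_I_smul, ← map_smul, h]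

/-! ### Multiplication by `i` and the subspace `iK` -/

/-- Multiplication by `i`, as a real linear isometric equivalence. [folklore] -/
def rotI : H ≃ₗᵢ[ℝ] H :=
  { ((LinearEquiv.smulOfUnit (Units.mk0 (I : ℂ) I_ne_zero) : H ≃ₗ[ℂ] H).restrictScalars ℝ) with
    norm_map' := fun x => by
      change ‖(Units.mk0 (I : ℂ) I_ne_zero) • x‖ = ‖x‖
      rw [Units.smul_def, norm_smul]; simp }

omit [CompleteSpace H] in
/-- `rotI x = i x`. [folklore] -/
@[simp] theorem rotI_apply (x : H) : rotI x = (I : ℂ) • x := rfl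

/-- The real subspace `iK`. [cite: RieffelVandaele1977, §3 (p. 193)] -/
def mulI (K : Submodule ℝ H) : Submodule ℝ H :=
  K.map ((rotI (H := H)).toLinearEquiv : H →ₗ[ℝ] H)

omit [CompleteSpace H] in
/-- Membership in `iK`. [folklore] -/
theorem mem_mulI {K : Submodule ℝ H} {x : H} : x ∈ mulI K ↔ ∃ y ∈ K, (I : ℂ) • y = x := by
  simp only [mulI, Submodule.mem_map]
  rfl

omit [CompleteSpace H] in
/-- `y ∈ K ⟹ i y ∈ iK`. [folklore] -/
theorem I_smul_mem_mulI {K : Submodule ℝ H} {y : H} (hy : y ∈ K) : (I : ℂ) • y ∈ mulI K :=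
  mem_mulI.2 ⟨y, hy, rfl⟩

omit [CompleteSpace H] in
/-- `x ∈ iK ↔ -i x ∈ K`. [folklore] -/
theorem mem_mulI_iff {K : Submodule ℝ H} {x : H} : x ∈ mulI K ↔ (-I : ℂ) • x ∈ K := by
  rw [mem_mulI]
  constructor
  · rintro ⟨y, hy, rfl⟩
    rwa [smul_smul, show (-I : ℂ) * I = 1 by simp, one_smul]
  · intro h
    exact ⟨(-I : ℂ) • x, h, by rw [smul_smul, show I * (-I : ℂ) = 1 by simp, one_smul]⟩

/-- `iK` has an orthogonal projection when `K` does (image under the isometry `rotI`). [folklore] -/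
instance instHasOrthogonalProjectionMulI (K : Submodule ℝ H) [K.HasOrthogonalProjection] :
    (mulI K).HasOrthogonalProjection :=
  Submodule.HasOrthogonalProjection.map_linearIsometryEquiv K rotI

/-! ### The projections `P`, `Q` and the operator `R = P + Q` -/

section PQR

variable (K : Submodule ℝ H) [K.HasOrthogonalProjection]

omit [CompleteSpace H] in
/-- `⟪P x, x⟫_ℝ = ‖P x‖²` for a real orthogonal projection. [folklore] -/
theorem real_inner_starProjection_self (L : Submodule ℝ H) [L.HasOrthogonalProjection] (x : H) :
    ⟪L.starProjection x, x⟫_ℝ = ‖L.starProjection x‖ ^ 2 := by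
  have h0 : ⟪x - L.starProjection x, L.starProjection x⟫_ℝ = 0 :=
    L.starProjection_inner_eq_zero x _ (L.starProjection_apply_mem x)
  have : ⟪L.starProjection x, x⟫_ℝ =
      ⟪L.starProjection x, L.starProjection x⟫_ℝ + ⟪L.starProjection x, x - L.starProjection x⟫_ℝ := by
    rw [← inner_add_right, add_sub_cancel]
  rw [this, inner_eq_zero_symm.1 h0, add_zero, real_inner_self_eq_norm_sq]

omit [CompleteSpace H] in
/-- `⟪x - P x, x⟫_ℝ = ‖x - P x‖²`. [folklore] -/
theorem real_inner_sub_starProjection_self (L : Submodule ℝ H) [L.HasOrthogonalProjection] (x : H) :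
    ⟪x - L.starProjection x, x⟫_ℝ = ‖x - L.starProjection x‖ ^ 2 := by
  have h0 : ⟪x - L.starProjection x, L.starProjection x⟫_ℝ = 0 :=
    L.starProjection_inner_eq_zero x _ (L.starProjection_apply_mem x)
  have : ⟪x - L.starProjection x, x⟫_ℝ =
      ⟪x - L.starProjection x, x - L.starProjection x⟫_ℝ + ⟪x - L.starProjection x, L.starProjection x⟫_ℝ := by
    rw [← inner_add_right, sub_add_cancel]
  rw [this, h0, add_zero, real_inner_self_eq_norm_sq]

omit [CompleteSpace H] in
/-- **`Q (i x) = i P x`** (Rieffel–van Daele Prop. 3.1: "`iP = Qi`"). [cite: RieffelVandaele1977, Prop. 3.1] -/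
theorem starProjection_mulI_I_smul (x : H) :
    (mulI K).starProjection ((I : ℂ) • x) = (I : ℂ) • K.starProjection x := by
  apply Submodule.eq_starProjection_of_mem_of_inner_eq_zero
  · exact I_smul_mem_mulI (K.starProjection_apply_mem x)
  · intro w hw
    obtain ⟨y, hy, rfl⟩ := mem_mulI.1 hw
    rw [← smul_sub, real_inner_eq_re, inner_I_smul_I_smul, ← real_inner_eq_re]
    exact K.starProjection_inner_eq_zero x y hy

omit [CompleteSpace H] in
/-- `Q x = i P (-i x)`. [cite: RieffelVandaele1977, Prop. 3.1] -/
theorem starProjection_mulI_apply (x : H) :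
    (mulI K).starProjection x = (I : ℂ) • K.starProjection ((-I : ℂ) • x) := by
  have h := starProjection_mulI_I_smul K ((-I : ℂ) • x)
  rwa [smul_smul, show I * (-I : ℂ) = 1 by simp, one_smul] at h

omit [CompleteSpace H] in
/-- **`P (i x) = i Q x`**. [cite: RieffelVandaele1977, Prop. 3.1] -/
theorem starProjection_I_smul (x : H) :
    K.starProjection ((I : ℂ) • x) = (I : ℂ) • (mulI K).starProjection x := by
  rw [starProjection_mulI_apply K x, smul_smul, show I * (I : ℂ) = -1 by simp, neg_one_smul,
    show (-I : ℂ) • x = -((I : ℂ) • x) by rw [neg_smul], map_neg, neg_neg]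

omit [CompleteSpace H] in
/-- The real-linear map `R = P + Q` commutes with `i`. [cite: RieffelVandaele1977, Prop. 3.1] -/
theorem starProjection_add_I_smul (x : H) :
    K.starProjection ((I : ℂ) • x) + (mulI K).starProjection ((I : ℂ) • x) =
      (I : ℂ) • (K.starProjection x + (mulI K).starProjection x) := by
  rw [starProjection_I_smul, starProjection_mulI_I_smul, smul_add, add_comm]

/-- **The operator `R = P + Q`**, complex linear (Rieffel–van Daele Def. 2.1, Prop. 3.1: "`R` is
complex linear"). [cite: RieffelVandaele1977, Def. 2.1 and Prop. 3.1] -/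
def modR : H →L[ℂ] H where
  toFun x := K.starProjection x + (mulI K).starProjection x
  map_add' x y := by simp only [map_add]; abel
  map_smul' c x := by
    simp only [RingHom.id_apply]
    have hre : ∀ (r : ℝ) (v : H), K.starProjection (r • v) + (mulI K).starProjection (r • v) =
        r • (K.starProjection v + (mulI K).starProjection v) := fun r v => by
      rw [map_smul, map_smul, smul_add]
    calc K.starProjection (c • x) + (mulI K).starProjection (c • x)
        = K.starProjection (c.re • x + c.im • ((I : ℂ) • x)) +
            (mulI K).starProjection (c.re • x + c.im • ((I : ℂ) • x)) := by rw [← complex_smul_eq c x]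
      _ = c.re • (K.starProjection x + (mulI K).starProjection x) +
            c.im • (K.starProjection ((I : ℂ) • x) + (mulI K).starProjection ((I : ℂ) • x)) := by
          rw [map_add, map_add, ← hre, ← hre]; abel
      _ = c • (K.starProjection x + (mulI K).starProjection x) := by
          rw [starProjection_add_I_smul, ← complex_smul_eq]
  cont := by fun_prop

omit [CompleteSpace H] in
/-- `R x = P x + Q x`. [cite: RieffelVandaele1977, Def. 2.1] -/
theorem modR_apply (x : H) : modR K x = K.starProjection x + (mulI K).starProjection x := rfl

omit [CompleteSpace H] in
/-- `⟪R x, x⟫_ℝ = ‖P x‖² + ‖Q x‖²`. [cite: RieffelVandaele1977, Prop. 2.2 (1)] -/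
theorem re_inner_modR_self (x : H) :
    (⟪modR K x, x⟫_ℂ).re = ‖K.starProjection x‖ ^ 2 + ‖(mulI K).starProjection x‖ ^ 2 := by
  rw [← real_inner_eq_re, modR_apply, inner_add_left, real_inner_starProjection_self,
    real_inner_starProjection_self]

omit [CompleteSpace H] in
/-- `R` is symmetric for the real inner product. [cite: RieffelVandaele1977, Prop. 2.2] -/
theorem re_inner_modR_symm (x y : H) : (⟪modR K x, y⟫_ℂ).re = (⟪x, modR K y⟫_ℂ).re := by
  rw [← real_inner_eq_re, ← real_inner_eq_re, modR_apply, modR_apply, inner_add_left,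
    inner_add_right, Submodule.inner_starProjection_left_eq_right,
    Submodule.inner_starProjection_left_eq_right]

/-- **`R` is self-adjoint.** [cite: RieffelVandaele1977, Prop. 2.2 (1) and Prop. 3.1] -/
theorem modR_isSelfAdjoint : IsSelfAdjoint (modR K) :=
  isSelfAdjoint_of_re_inner_symm _ (re_inner_modR_symm K)

omit [CompleteSpace H] in
/-- The numeral `2` acts as the scalar `2`. [folklore] -/
theorem two_apply (x : H) : (2 : H →L[ℂ] H) x = (2 : ℂ) • x := by
  rw [show (2 : H →L[ℂ] H) = 1 + 1 by norm_num, add_apply, one_apply_eq_self, two_smul]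

omit [CompleteSpace H] in
/-- `⟪(2 - R) x, x⟫_ℝ = ‖x - P x‖² + ‖x - Q x‖²`. [cite: RieffelVandaele1977, Prop. 2.2 (1)] -/
theorem re_inner_two_sub_modR_self (x : H) :
    (⟪(2 - modR K) x, x⟫_ℂ).re =
      ‖x - K.starProjection x‖ ^ 2 + ‖x - (mulI K).starProjection x‖ ^ 2 := by
  have : (2 - modR K) x = (x - K.starProjection x) + (x - (mulI K).starProjection x) := by
    rw [sub_apply, two_apply, modR_apply, two_smul]; abel
  rw [this, ← real_inner_eq_re, inner_add_left, real_inner_sub_starProjection_self,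
    real_inner_sub_starProjection_self]

/-- **`0 ≤ R`** (Loewner order). [cite: RieffelVandaele1977, Prop. 2.2 (1)] -/
theorem modR_nonneg : 0 ≤ modR K := by
  rw [ContinuousLinearMap.nonneg_iff_isPositive]
  refine ⟨ContinuousLinearMap.isSelfAdjoint_iff_isSymmetric.1 (modR_isSelfAdjoint K), fun x => ?_⟩
  rw [ContinuousLinearMap.reApplyInnerSelf_apply, RCLike.re_to_complex, re_inner_modR_self]
  positivity

/-- `2 - R` is self-adjoint. [cite: RieffelVandaele1977, Prop. 2.2 (1)] -/
theorem two_sub_modR_isSelfAdjoint : IsSelfAdjoint (2 - modR K) :=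
  IsSelfAdjoint.sub (IsSelfAdjoint.ofNat 2) (modR_isSelfAdjoint K)

/-- **`R ≤ 2`** (Loewner order). [cite: RieffelVandaele1977, Prop. 2.2 (1)] -/
theorem modR_le_two : modR K ≤ 2 := by
  rw [ContinuousLinearMap.le_def]
  refine ⟨ContinuousLinearMap.isSelfAdjoint_iff_isSymmetric.1 (two_sub_modR_isSelfAdjoint K),
    fun x => ?_⟩
  rw [ContinuousLinearMap.reApplyInnerSelf_apply, RCLike.re_to_complex, re_inner_two_sub_modR_self]
  positivity

/-- The real spectrum of `R` lies in `[0, 2]`. [cite: RieffelVandaele1977, Prop. 2.2 (1)] -/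
theorem spectrum_modR_subset : spectrum ℝ (modR K) ⊆ Set.Icc 0 2 := by
  intro t ht
  refine ⟨spectrum_nonneg_of_nonneg (modR_nonneg K) ht, ?_⟩
  have h2 : modR K ≤ algebraMap ℝ (H →L[ℂ] H) 2 := by
    rw [map_ofNat]; exact modR_le_two K
  exact (le_algebraMap_iff_spectrum_le (modR_isSelfAdjoint K)).1 h2 t ht

/-- **`R` is injective** when `K + iK` is dense (Rieffel–van Daele Prop. 2.2 (1)).
[cite: RieffelVandaele1977, Prop. 2.2 (1)] -/
theorem modR_injective (hdense : Dense ((K ⊔ mulI K : Submodule ℝ H) : Set H)) :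
    Function.Injective (modR K) := by
  rw [injective_iff_map_eq_zero]
  intro x hx
  have h0 : ‖K.starProjection x‖ ^ 2 + ‖(mulI K).starProjection x‖ ^ 2 = 0 := by
    rw [← re_inner_modR_self, hx, inner_zero_left, Complex.zero_re]
  have hP : K.starProjection x = 0 := by
    have : ‖K.starProjection x‖ ^ 2 = 0 := by
      nlinarith [sq_nonneg (‖K.starProjection x‖), sq_nonneg (‖(mulI K).starProjection x‖)]
    exact norm_eq_zero.mp ((pow_eq_zero_iff two_ne_zero).mp this)
  have hQ : (mulI K).starProjection x = 0 := by
    have : ‖(mulI K).starProjection x‖ ^ 2 = 0 := by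
      nlinarith [sq_nonneg (‖K.starProjection x‖), sq_nonneg (‖(mulI K).starProjection x‖)]
    exact norm_eq_zero.mp ((pow_eq_zero_iff two_ne_zero).mp this)
  rw [Submodule.starProjection_apply_eq_zero_iff] at hP hQ
  have hx' : x ∈ (K ⊔ mulI K)ᗮ := by
    rw [← Submodule.inf_orthogonal]; exact ⟨hP, hQ⟩
  have hbot : (K ⊔ mulI K)ᗮ = ⊥ := by
    rw [← Submodule.topologicalClosure_eq_top_iff]
    exact Submodule.dense_iff_topologicalClosure_eq_top.1 hdense
  rw [hbot] at hx'
  exact (Submodule.mem_bot ℝ).1 hx'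

omit [CompleteSpace H] in
/-- **`2 - R` is injective** when `K ∩ iK = 0` (Rieffel–van Daele Prop. 2.2 (1)).
[cite: RieffelVandaele1977, Prop. 2.2 (1)] -/
theorem two_sub_modR_injective (hsep : ∀ x, x ∈ K → x ∈ mulI K → x = 0) :
    Function.Injective ((2 - modR K : H →L[ℂ] H)) := by
  rw [injective_iff_map_eq_zero]
  intro x hx
  have h0 : ‖x - K.starProjection x‖ ^ 2 + ‖x - (mulI K).starProjection x‖ ^ 2 = 0 := by
    rw [← re_inner_two_sub_modR_self, hx, inner_zero_left, Complex.zero_re]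
  have hP : x - K.starProjection x = 0 := by
    have : ‖x - K.starProjection x‖ ^ 2 = 0 := by
      nlinarith [sq_nonneg (‖x - K.starProjection x‖), sq_nonneg (‖x - (mulI K).starProjection x‖)]
    exact norm_eq_zero.mp ((pow_eq_zero_iff two_ne_zero).mp this)
  have hQ : x - (mulI K).starProjection x = 0 := by
    have : ‖x - (mulI K).starProjection x‖ ^ 2 = 0 := by
      nlinarith [sq_nonneg (‖x - K.starProjection x‖), sq_nonneg (‖x - (mulI K).starProjection x‖)]
    exact norm_eq_zero.mp ((pow_eq_zero_iff two_ne_zero).mp this)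
  rw [sub_eq_zero] at hP hQ
  exact hsep x (hP ▸ K.starProjection_apply_mem x) (hQ ▸ (mulI K).starProjection_apply_mem x)

end PQR

/-! ### The conjugate-linear `B = P − Q` and `T = (R(2−R))^{1/2} = |P − Q|` -/

section BT

variable (K : Submodule ℝ H) [K.HasOrthogonalProjection]

/-- **The operator `P − Q`** (conjugate linear; Rieffel–van Daele Def. 2.1, Prop. 3.1:
"`P − Q` is conjugate linear"), as a real continuous linear map. [cite: RieffelVandaele1977, Def. 2.1 and Prop. 3.1] -/
def modB : H →L[ℝ] H := K.starProjection - (mulI K).starProjection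

omit [CompleteSpace H] in
/-- `B x = P x - Q x`. [cite: RieffelVandaele1977, Def. 2.1] -/
theorem modB_apply (x : H) : modB K x = K.starProjection x - (mulI K).starProjection x := rfl

omit [CompleteSpace H] in
/-- **`P − Q` is conjugate linear**: `B (i x) = -i B x`. [cite: RieffelVandaele1977, Prop. 3.1] -/
theorem modB_I_smul (x : H) : modB K ((I : ℂ) • x) = -((I : ℂ) • modB K x) := by
  rw [modB_apply, modB_apply, starProjection_I_smul, starProjection_mulI_I_smul, smul_sub,
    neg_sub]

omit [CompleteSpace H] in
/-- `B (c x) = c̄ B x`. [cite: RieffelVandaele1977, Prop. 3.1] -/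
theorem modB_smul (c : ℂ) (x : H) : modB K (c • x) = conj c • modB K x := by
  rw [complex_smul_eq c x, map_add, map_smul, map_smul, modB_I_smul, complex_smul_eq (conj c)]
  simp only [Complex.conj_re, Complex.conj_im, neg_smul, smul_neg]

omit [CompleteSpace H] in
/-- `P − Q` is symmetric for the real inner product. [cite: RieffelVandaele1977, Prop. 2.2] -/
theorem real_inner_modB_symm (x y : H) : ⟪modB K x, y⟫_ℝ = ⟪x, modB K y⟫_ℝ := by
  rw [modB_apply, modB_apply, inner_sub_left, inner_sub_right,
    Submodule.inner_starProjection_left_eq_right, Submodule.inner_starProjection_left_eq_right]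

omit [CompleteSpace H] in
/-- `P (P x) = P x`. [folklore] -/
theorem starProjection_starProjection (L : Submodule ℝ H) [L.HasOrthogonalProjection] (x : H) :
    L.starProjection (L.starProjection x) = L.starProjection x :=
  Submodule.starProjection_eq_self_iff.2 (L.starProjection_apply_mem x)

omit [CompleteSpace H] in
/-- **`(P − Q)² = R (2 − R)`** (Rieffel–van Daele, proof of Prop. 2.2 (2):
"`T² = P − PQ − QP + Q = R(2 − R)`"). [cite: RieffelVandaele1977, Prop. 2.2 (2)] -/
theorem modB_modB (x : H) : modB K (modB K x) = (modR K * (2 - modR K)) x := by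
  rw [mul_apply_eq_comp, sub_apply, two_apply, two_smul, modR_apply, modR_apply, modB_apply,
    modB_apply]
  simp only [map_sub, map_add, starProjection_starProjection]
  abel_nf

/-- **The operator `T² = R (2 − R)`**. [cite: RieffelVandaele1977, Prop. 2.2 (2)] -/
def modTsq : H →L[ℂ] H := modR K * (2 - modR K)

omit [CompleteSpace H] in
/-- `T² x = B (B x)`. [cite: RieffelVandaele1977, Prop. 2.2 (2)] -/
theorem modTsq_apply (x : H) : modTsq K x = modB K (modB K x) := (modB_modB K x).symm

omit [CompleteSpace H] in
/-- `⟪T² x, x⟫_ℝ = ‖B x‖²`. [cite: RieffelVandaele1977, Prop. 2.2 (2)] -/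
theorem re_inner_modTsq_self (x : H) : (⟪modTsq K x, x⟫_ℂ).re = ‖modB K x‖ ^ 2 := by
  rw [← real_inner_eq_re, modTsq_apply, real_inner_modB_symm, real_inner_self_eq_norm_sq]

omit [CompleteSpace H] in
/-- `T²` is symmetric for the real inner product. [cite: RieffelVandaele1977, Prop. 2.2 (2)] -/
theorem re_inner_modTsq_symm (x y : H) : (⟪modTsq K x, y⟫_ℂ).re = (⟪x, modTsq K y⟫_ℂ).re := by
  rw [← real_inner_eq_re, ← real_inner_eq_re, modTsq_apply, modTsq_apply, real_inner_modB_symm,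
    real_inner_modB_symm]

/-- `T²` is self-adjoint. [cite: RieffelVandaele1977, Prop. 2.2 (2)] -/
theorem modTsq_isSelfAdjoint : IsSelfAdjoint (modTsq K) :=
  isSelfAdjoint_of_re_inner_symm _ (re_inner_modTsq_symm K)

/-- **`0 ≤ T²`**. [cite: RieffelVandaele1977, Prop. 2.2 (2)] -/
theorem modTsq_nonneg : 0 ≤ modTsq K := by
  rw [ContinuousLinearMap.nonneg_iff_isPositive]
  refine ⟨ContinuousLinearMap.isSelfAdjoint_iff_isSymmetric.1 (modTsq_isSelfAdjoint K), fun x => ?_⟩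
  rw [ContinuousLinearMap.reApplyInnerSelf_apply, RCLike.re_to_complex, re_inner_modTsq_self]
  positivity

omit [CompleteSpace H] in
/-- `B` commutes with `T²` (trivially: `T² = B²`). [cite: RieffelVandaele1977, Prop. 2.2 (4)] -/
theorem modB_modTsq (x : H) : modB K (modTsq K x) = modTsq K (modB K x) := by
  rw [modTsq_apply, modTsq_apply]

omit [CompleteSpace H] in
/-- `P` commutes with `T²` (Rieffel–van Daele, proof of Prop. 2.2 (4): "`T²P = P(1 − Q)P = PT²`").
[cite: RieffelVandaele1977, Prop. 2.2 (4)] -/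
theorem starProjection_modTsq (x : H) :
    K.starProjection (modTsq K x) = modTsq K (K.starProjection x) := by
  rw [modTsq_apply, modTsq_apply, modB_apply, modB_apply, modB_apply, modB_apply]
  simp only [map_sub, starProjection_starProjection]
  abel

omit [CompleteSpace H] in
/-- `Q` commutes with `T²`. [cite: RieffelVandaele1977, Prop. 2.2 (4)] -/
theorem starProjection_mulI_modTsq (x : H) :
    (mulI K).starProjection (modTsq K x) = modTsq K ((mulI K).starProjection x) := by
  rw [modTsq_apply, modTsq_apply, modB_apply, modB_apply, modB_apply, modB_apply]
  simp only [map_sub, starProjection_starProjection]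
  abel

omit [CompleteSpace H] in
/-- `R` commutes with `T²`. [cite: RieffelVandaele1977, Prop. 2.2 (4)] -/
theorem modR_commute_modTsq : Commute (modR K) (modTsq K) :=
  (Commute.refl _).mul_right ((Commute.ofNat_right _ 2).sub_right (Commute.refl _))

/-- **The operator `T = (R(2−R))^{1/2}`** (Rieffel–van Daele Def. 2.1 / Prop. 2.2 (2): the
positive part of the polar decomposition of `P − Q`), via the continuous functional calculus.
[cite: RieffelVandaele1977, Def. 2.1 and Prop. 2.2 (2)] -/
def modT : H →L[ℂ] H := cfc Real.sqrt (modTsq K)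

/-- `T` is self-adjoint. [cite: RieffelVandaele1977, Prop. 2.2 (2)] -/
theorem modT_isSelfAdjoint : IsSelfAdjoint (modT K) := by
  unfold modT; exact cfc_predicate _ _

/-- **`0 ≤ T`**. [cite: RieffelVandaele1977, Prop. 2.2 (2)] -/
theorem modT_nonneg : 0 ≤ modT K := by
  unfold modT
  exact cfc_nonneg fun x _ => Real.sqrt_nonneg x

/-- **`T² = R (2 − R)`** as operators: `T * T = modTsq`. [cite: RieffelVandaele1977, Prop. 2.2 (2)] -/
theorem modT_mul_modT : modT K * modT K = modTsq K := by
  unfold modT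
  rw [← cfc_mul Real.sqrt Real.sqrt (modTsq K)]
  conv_rhs => rw [← cfc_id' ℝ (modTsq K) (modTsq_isSelfAdjoint K)]
  exact cfc_congr fun t ht => Real.mul_self_sqrt (spectrum_nonneg_of_nonneg (modTsq_nonneg K) ht)

/-- `T (T x) = B (B x)`. [cite: RieffelVandaele1977, Prop. 2.2 (2)] -/
theorem modT_modT_apply (x : H) : modT K (modT K x) = modB K (modB K x) := by
  rw [← mul_apply_eq_comp, modT_mul_modT, modTsq_apply]

/-- **`‖T x‖ = ‖(P − Q) x‖`** (so `P − Q = J T` with `J` isometric). [cite: RieffelVandaele1977, Prop. 2.2 (2)–(3)] -/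
theorem norm_modT_apply (x : H) : ‖modT K x‖ = ‖modB K x‖ := by
  have hT : (⟪modT K x, modT K x⟫_ℂ).re = (⟪modTsq K x, x⟫_ℂ).re := by
    have hsym := ContinuousLinearMap.isSelfAdjoint_iff_isSymmetric.1 (modT_isSelfAdjoint K)
    rw [← modT_mul_modT, mul_apply_eq_comp]
    exact congrArg Complex.re (hsym (modT K x) x).symm |> fun h => by
      simpa only [ContinuousLinearMap.coe_coe] using h.symm |> fun h' => h'.symm
  have h1 : ‖modT K x‖ ^ 2 = ‖modB K x‖ ^ 2 := by
    rw [← re_inner_modTsq_self, ← hT, inner_self_eq_norm_sq_to_K]; norm_cast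
  exact (sq_eq_sq₀ (norm_nonneg _) (norm_nonneg _)).1 h1 |> fun h => by
    nlinarith [norm_nonneg (modT K x), norm_nonneg (modB K x), h1]

/-- **`T` commutes with `P − Q`** (Rieffel–van Daele Prop. 2.2 (4): "since `P − Q` is self-adjoint,
`T` and `J` commute"; here via polynomial approximation of the square root).
[cite: RieffelVandaele1977, Prop. 2.2 (4)] -/
theorem modB_modT (x : H) : modB K (modT K x) = modT K (modB K x) := by
  unfold modT
  exact realCLM_apply_cfc_comm (modB K) (modTsq_isSelfAdjoint K) (modB_modTsq K)
    Real.continuous_sqrt x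

/-- **`T` commutes with `P`**. [cite: RieffelVandaele1977, Prop. 2.2 (4)] -/
theorem starProjection_modT (x : H) :
    K.starProjection (modT K x) = modT K (K.starProjection x) := by
  unfold modT
  exact realCLM_apply_cfc_comm K.starProjection (modTsq_isSelfAdjoint K) (starProjection_modTsq K)
    Real.continuous_sqrt x

/-- **`T` commutes with `Q`**. [cite: RieffelVandaele1977, Prop. 2.2 (4)] -/
theorem starProjection_mulI_modT (x : H) :
    (mulI K).starProjection (modT K x) = modT K ((mulI K).starProjection x) := by
  unfold modT
  exact realCLM_apply_cfc_comm (mulI K).starProjection (modTsq_isSelfAdjoint K)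
    (starProjection_mulI_modTsq K) Real.continuous_sqrt x

/-- **`T` commutes with `R`**. [cite: RieffelVandaele1977, Prop. 2.2 (4)] -/
theorem modR_commute_modT : Commute (modR K) (modT K) := by
  unfold modT
  exact ((modR_commute_modTsq K).symm.cfc_real Real.sqrt).symm

/-- `T` is injective when `K ∩ iK = 0` and `K + iK` is dense. [cite: RieffelVandaele1977, Prop. 2.2 (2)] -/
theorem modT_injective (hsep : ∀ x, x ∈ K → x ∈ mulI K → x = 0)
    (hdense : Dense ((K ⊔ mulI K : Submodule ℝ H) : Set H)) : Function.Injective (modT K) := by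
  rw [injective_iff_map_eq_zero]
  intro x hx
  have hB : modB K x = 0 := by rw [← norm_eq_zero, ← norm_modT_apply, hx, norm_zero]
  have hTsq : modTsq K x = 0 := by rw [modTsq_apply, hB, map_zero]
  have h2 : (2 - modR K) x = 0 := by
    apply modR_injective K hdense
    rw [map_zero, ← mul_apply_eq_comp]
    exact hTsq
  exact two_sub_modR_injective K hsep (by rw [h2, map_zero])

/-- `B = P − Q` is injective when `K ∩ iK = 0` and `K + iK` is dense. [cite: RieffelVandaele1977, Prop. 2.2 (2)] -/
theorem modB_injective (hsep : ∀ x, x ∈ K → x ∈ mulI K → x = 0)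
    (hdense : Dense ((K ⊔ mulI K : Submodule ℝ H) : Set H)) : Function.Injective (modB K) := by
  rw [injective_iff_map_eq_zero]
  intro x hx
  apply modT_injective K hsep hdense
  rw [map_zero, ← norm_eq_zero, norm_modT_apply, hx, norm_zero]

/-- The range of `T` is dense. [cite: RieffelVandaele1977, Prop. 2.2 (2)] -/
theorem dense_span_range_modT (hsep : ∀ x, x ∈ K → x ∈ mulI K → x = 0)
    (hdense : Dense ((K ⊔ mulI K : Submodule ℝ H) : Set H)) :
    Dense (Submodule.span ℂ (Set.range (modT K)) : Set H) := by
  rw [Submodule.dense_iff_topologicalClosure_eq_top, Submodule.topologicalClosure_eq_top_iff,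
    Submodule.eq_bot_iff]
  intro y hy
  have hTy : modT K y = 0 := by
    refine ext_inner_left ℂ fun x => ?_
    have hsym := ContinuousLinearMap.isSelfAdjoint_iff_isSymmetric.1 (modT_isSelfAdjoint K)
    rw [inner_zero_right]
    have h := hy (modT K x) (Submodule.subset_span ⟨x, rfl⟩)
    -- `⟪T x, y⟫ = 0 = ⟪x, T y⟫`
    have : ⟪modT K x, y⟫_ℂ = ⟪x, modT K y⟫_ℂ := by
      simpa only [ContinuousLinearMap.coe_coe] using hsym x y
    rw [← this, h]
  exact modT_injective K hsep hdense (by rw [hTy, map_zero])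

/-- The range of `P − Q` spans a dense subspace. [cite: RieffelVandaele1977, Prop. 2.2 (3)] -/
theorem dense_span_range_modB (hsep : ∀ x, x ∈ K → x ∈ mulI K → x = 0)
    (hdense : Dense ((K ⊔ mulI K : Submodule ℝ H) : Set H)) :
    Dense (Submodule.span ℂ (Set.range (modB K)) : Set H) := by
  rw [Submodule.dense_iff_topologicalClosure_eq_top, Submodule.topologicalClosure_eq_top_iff,
    Submodule.eq_bot_iff]
  intro y hy
  have hBy : modB K y = 0 := by
    apply ext_real_inner
    intro v
    rw [inner_zero_left, Complex.zero_re]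
    have h := hy (modB K v) (Submodule.subset_span ⟨v, rfl⟩)
    calc (⟪modB K y, v⟫_ℂ).re = (⟪v, modB K y⟫_ℂ).re := by rw [← inner_conj_symm, Complex.conj_re]
      _ = ⟪v, modB K y⟫_ℝ := rfl
      _ = ⟪modB K v, y⟫_ℝ := (real_inner_modB_symm K v y).symm
      _ = (⟪modB K v, y⟫_ℂ).re := rfl
      _ = 0 := by rw [h, Complex.zero_re]
  exact modB_injective K hsep hdense (by rw [hBy, map_zero])

/-- **`⟪(P−Q) x, (P−Q) y⟫ = ⟪T y, T x⟫`**: the assignment `T x ↦ (P − Q) x` reverses inner products,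
so that it extends to an antiunitary `J` with `J T = P − Q`. [cite: RieffelVandaele1977, Prop. 2.2 (3) and Prop. 3.1] -/
theorem inner_modB_modB (x y : H) : ⟪modB K x, modB K y⟫_ℂ = ⟪modT K y, modT K x⟫_ℂ := by
  have hsym := ContinuousLinearMap.isSelfAdjoint_iff_isSymmetric.1 (modT_isSelfAdjoint K)
  -- real parts
  have hre : ∀ x y : H, (⟪modB K x, modB K y⟫_ℂ).re = (⟪modT K y, modT K x⟫_ℂ).re := by
    intro x y
    rw [← real_inner_eq_re, real_inner_modB_symm, ← modT_modT_apply, real_inner_eq_re]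
    have h1 : ⟪x, modT K (modT K y)⟫_ℂ = ⟪modT K x, modT K y⟫_ℂ := by
      simpa only [ContinuousLinearMap.coe_coe] using (hsym x (modT K y)).symm
    rw [h1, ← inner_conj_symm, Complex.conj_re]
  apply Complex.ext (hre x y)
  rw [im_inner_eq_neg_re_inner_I_smul, show (I : ℂ) • modB K y = -modB K ((I : ℂ) • y) by
    rw [modB_I_smul, neg_neg], inner_neg_right, Complex.neg_re, neg_neg, hre, map_smul,
    inner_smul_left]
  simp

end BT

/-! ### Antiunitaries -/

section Antiunitary

omit [CompleteSpace H] in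
/-- An antiunitary (conjugate-linear isometric equivalence) reverses inner products:
`⟪Θ x, Θ y⟫ = ⟪y, x⟫` (polarization). [folklore] -/
theorem antiunitary_inner_map_map (Θ : H ≃ₗᵢ⋆[ℂ] H) (x y : H) : ⟪Θ x, Θ y⟫_ℂ = ⟪y, x⟫_ℂ := by
  rw [inner_eq_sum_norm_sq_div_four, inner_eq_sum_norm_sq_div_four]
  have h1 : ‖Θ x + Θ y‖ = ‖y + x‖ := by rw [← map_add, Θ.norm_map, add_comm]
  have h2 : ‖Θ x - Θ y‖ = ‖y - x‖ := by rw [← map_sub, Θ.norm_map, norm_sub_rev]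
  have h3 : ‖Θ x - (RCLike.I : ℂ) • Θ y‖ = ‖y - (RCLike.I : ℂ) • x‖ := by
    have : Θ x - (RCLike.I : ℂ) • Θ y = Θ (x + (I : ℂ) • y) := by
      rw [map_add, LinearIsometryEquiv.map_smulₛₗ]; simp [sub_eq_add_neg]
    rw [this, Θ.norm_map]
    have : x + (I : ℂ) • y = (I : ℂ) • (y - (RCLike.I : ℂ) • x) := by
      simp [smul_sub, smul_smul]; abel
    rw [this, norm_smul]; simp
  have h4 : ‖Θ x + (RCLike.I : ℂ) • Θ y‖ = ‖y + (RCLike.I : ℂ) • x‖ := by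
    have : Θ x + (RCLike.I : ℂ) • Θ y = Θ (x - (I : ℂ) • y) := by
      rw [map_sub, LinearIsometryEquiv.map_smulₛₗ]; simp [sub_eq_add_neg]
    rw [this, Θ.norm_map]
    have : x - (I : ℂ) • y = (-I : ℂ) • (y + (RCLike.I : ℂ) • x) := by
      simp [smul_add, smul_smul]; abel
    rw [this, norm_smul]; simp
  rw [h1, h2, h3, h4]

omit [CompleteSpace H] in
/-- An antiunitary as a real continuous linear map. [folklore] -/
def antiunitaryToRealCLM (Θ : H ≃ₗᵢ⋆[ℂ] H) : H →L[ℝ] H where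
  toFun := Θ
  map_add' := map_add Θ
  map_smul' r x := by
    change Θ ((r : ℂ) • x) = (r : ℂ) • Θ x
    rw [LinearIsometryEquiv.map_smulₛₗ]; simp
  cont := Θ.continuous

omit [CompleteSpace H] in
/-- Unfolding `antiunitaryToRealCLM`. [folklore] -/
@[simp] theorem antiunitaryToRealCLM_apply (Θ : H ≃ₗᵢ⋆[ℂ] H) (x : H) :
    antiunitaryToRealCLM Θ x = Θ x := rfl

end Antiunitary

/-! ### The modular conjugation `J` of a standard real subspace -/

section J

variable (K : Submodule ℝ H) [K.HasOrthogonalProjection]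

/-- Existence of the phase `J` of `P − Q = J T`: an antiunitary with `J (T x) = (P − Q) x`.
[cite: RieffelVandaele1977, Def. 2.1 and Prop. 3.1] -/
theorem exists_modJ (hsep : ∀ x, x ∈ K → x ∈ mulI K → x = 0)
    (hdense : Dense ((K ⊔ mulI K : Submodule ℝ H) : Set H)) : ∃ Θ : H ≃ₗᵢ⋆[ℂ] H, ∀ x, Θ (modT K x) = modB K x :=
  exists_antiunitary_extending (fun x => modT K x) (fun x => modB K x)
    (dense_span_range_modT K hsep hdense) (dense_span_range_modB K hsep hdense)
    (fun x y => inner_modB_modB K x y)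

/-- **The modular conjugation `J`** of the standard real subspace `K` (Rieffel–van Daele Def. 2.1:
the partial isometry of the polar decomposition `P − Q = J T`; Prop. 3.1: "`J` is a conjugate linear
isometry"), here the antiunitary extension of `T x ↦ (P − Q) x`. [cite: RieffelVandaele1977, Def. 2.1 and Prop. 3.1] -/
def modJ (hsep : ∀ x, x ∈ K → x ∈ mulI K → x = 0)
    (hdense : Dense ((K ⊔ mulI K : Submodule ℝ H) : Set H)) : H ≃ₗᵢ⋆[ℂ] H := Classical.choose (exists_modJ K hsep hdense)

/-- **Polar decomposition `J T = P − Q`**. [cite: RieffelVandaele1977, Def. 2.1] -/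
theorem modJ_modT (hsep : ∀ x, x ∈ K → x ∈ mulI K → x = 0)
    (hdense : Dense ((K ⊔ mulI K : Submodule ℝ H) : Set H)) (x : H) : modJ K hsep hdense (modT K x) = modB K x :=
  Classical.choose_spec (exists_modJ K hsep hdense) x

/-- `⟪J x, J y⟫ = ⟪y, x⟫`. [cite: RieffelVandaele1977, Prop. 3.1] -/
theorem inner_modJ_modJ (hsep : ∀ x, x ∈ K → x ∈ mulI K → x = 0)
    (hdense : Dense ((K ⊔ mulI K : Submodule ℝ H) : Set H)) (x y : H) :
    ⟪modJ K hsep hdense x, modJ K hsep hdense y⟫_ℂ = ⟪y, x⟫_ℂ :=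
  antiunitary_inner_map_map _ x y

/-- The range of `T` is dense (set form). [cite: RieffelVandaele1977, Prop. 2.2 (2)] -/
theorem dense_range_modT (hsep : ∀ x, x ∈ K → x ∈ mulI K → x = 0)
    (hdense : Dense ((K ⊔ mulI K : Submodule ℝ H) : Set H)) : Dense (Set.range (modT K)) := by
  -- the range of a complex-linear map is a subspace, so its span is itself
  have : (Submodule.span ℂ (Set.range (modT K)) : Set H) = Set.range (modT K) := by
    rw [show Set.range (modT K) = (LinearMap.range (modT K : H →ₗ[ℂ] H) : Set H) from
      (LinearMap.coe_range _).symm, Submodule.span_eq]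
  rw [← this]
  exact dense_span_range_modT K hsep hdense

/-- **`J` is symmetric for the real inner product**: `Re ⟪J u, v⟫ = Re ⟪u, J v⟫` (Rieffel–van Daele
Prop. 2.2 (3): "since `P − Q` is self-adjoint, `J` must be self-adjoint").
[cite: RieffelVandaele1977, Prop. 2.2 (3)] -/
theorem re_inner_modJ_symm (hsep : ∀ x, x ∈ K → x ∈ mulI K → x = 0)
    (hdense : Dense ((K ⊔ mulI K : Submodule ℝ H) : Set H)) (u v : H) :
    (⟪modJ K hsep hdense u, v⟫_ℂ).re = (⟪u, modJ K hsep hdense v⟫_ℂ).re := by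
  have hsymT := ContinuousLinearMap.isSelfAdjoint_iff_isSymmetric.1 (modT_isSelfAdjoint K)
  have hT : ∀ a b : H, ⟪modT K a, b⟫_ℂ = ⟪a, modT K b⟫_ℂ := fun a b => by
    simpa only [ContinuousLinearMap.coe_coe] using hsymT a b
  -- on the dense range of `T` in both variables
  have h0 : ∀ x y : H, (⟪modJ K hsep hdense (modT K x), modT K y⟫_ℂ).re =
      (⟪modT K x, modJ K hsep hdense (modT K y)⟫_ℂ).re := by
    intro x y
    rw [modJ_modT, modJ_modT, ← real_inner_eq_re, ← real_inner_eq_re, real_inner_modB_symm,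
      real_inner_eq_re, real_inner_eq_re, modB_modT, ← hT]
  -- extend in the second variable
  have h1 : ∀ (x : H) (v : H), (⟪modJ K hsep hdense (modT K x), v⟫_ℂ).re =
      (⟪modT K x, modJ K hsep hdense v⟫_ℂ).re := by
    intro x
    have hc1 : Continuous fun v => (⟪modJ K hsep hdense (modT K x), v⟫_ℂ).re := by fun_prop
    have hc2 : Continuous fun v => (⟪modT K x, modJ K hsep hdense v⟫_ℂ).re :=
      Complex.continuous_re.comp ((continuous_const.inner (modJ K hsep hdense).continuous))
    have := Continuous.ext_on (dense_range_modT K hsep hdense) hc1 hc2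
      (by rintro _ ⟨y, rfl⟩; exact h0 x y)
    exact fun v => congrFun this v
  -- extend in the first variable
  have hc1 : Continuous fun u => (⟪modJ K hsep hdense u, v⟫_ℂ).re :=
    Complex.continuous_re.comp (((modJ K hsep hdense).continuous).inner continuous_const)
  have hc2 : Continuous fun u => (⟪u, modJ K hsep hdense v⟫_ℂ).re := by fun_prop
  have := Continuous.ext_on (dense_range_modT K hsep hdense) hc1 hc2
    (by rintro _ ⟨x, rfl⟩; exact h1 x v)
  exact congrFun this u

/-- **`J² = 1`** (Rieffel–van Daele Prop. 2.2 (3)). [cite: RieffelVandaele1977, Prop. 2.2 (3)] -/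
theorem modJ_modJ (hsep : ∀ x, x ∈ K → x ∈ mulI K → x = 0)
    (hdense : Dense ((K ⊔ mulI K : Submodule ℝ H) : Set H)) (u : H) : modJ K hsep hdense (modJ K hsep hdense u) = u := by
  apply ext_real_inner
  intro v
  rw [re_inner_modJ_symm, inner_modJ_modJ, ← inner_conj_symm, Complex.conj_re]

/-- `J` is an involution. [cite: RieffelVandaele1977, Prop. 2.2 (3)] -/
theorem modJ_involutive (hsep : ∀ x, x ∈ K → x ∈ mulI K → x = 0)
    (hdense : Dense ((K ⊔ mulI K : Submodule ℝ H) : Set H)) : Function.Involutive (modJ K hsep hdense) := modJ_modJ K hsep hdense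

/-- **`T J = J T`** (Rieffel–van Daele Prop. 2.2 (4)). [cite: RieffelVandaele1977, Prop. 2.2 (4)] -/
theorem modT_modJ (hsep : ∀ x, x ∈ K → x ∈ mulI K → x = 0)
    (hdense : Dense ((K ⊔ mulI K : Submodule ℝ H) : Set H)) (x : H) : modT K (modJ K hsep hdense x) = modJ K hsep hdense (modT K x) := by
  have hc1 : Continuous fun x => modT K (modJ K hsep hdense x) :=
    (modT K).continuous.comp (modJ K hsep hdense).continuous
  have hc2 : Continuous fun x => modJ K hsep hdense (modT K x) :=
    (modJ K hsep hdense).continuous.comp (modT K).continuous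
  have := Continuous.ext_on (dense_range_modT K hsep hdense) hc1 hc2 (by
    rintro _ ⟨y, rfl⟩
    change modT K (modJ K hsep hdense (modT K y)) = modJ K hsep hdense (modT K (modT K y))
    rw [modJ_modT, modJ_modT, modB_modT])
  exact congrFun this x

/-- `J (B x) = T x` (apply `J` to `J T = B`). [cite: RieffelVandaele1977, Def. 2.1] -/
theorem modJ_modB (hsep : ∀ x, x ∈ K → x ∈ mulI K → x = 0)
    (hdense : Dense ((K ⊔ mulI K : Submodule ℝ H) : Set H)) (x : H) : modJ K hsep hdense (modB K x) = modT K x := by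
  rw [← modJ_modT K hsep hdense, modJ_modJ]

/-- **`J P = (1 − Q) J`** (Rieffel–van Daele Prop. 2.2 (5)). [cite: RieffelVandaele1977, Prop. 2.2 (5)] -/
theorem modJ_starProjection (hsep : ∀ x, x ∈ K → x ∈ mulI K → x = 0)
    (hdense : Dense ((K ⊔ mulI K : Submodule ℝ H) : Set H)) (x : H) :
    modJ K hsep hdense (K.starProjection x) =
      modJ K hsep hdense x - (mulI K).starProjection (modJ K hsep hdense x) := by
  -- `T J P = B P = (1 - Q) B = (1 - Q) T J = T (1 - Q) J`, and `T` is injective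
  apply modT_injective K hsep hdense
  rw [modT_modJ, modJ_modT, map_sub, ← starProjection_mulI_modT, modT_modJ, modJ_modT, modB_apply,
    modB_apply]
  simp only [map_sub, starProjection_starProjection]
  abel

/-- **`J Q = (1 − P) J`** (Rieffel–van Daele Prop. 2.2 (5)). [cite: RieffelVandaele1977, Prop. 2.2 (5)] -/
theorem modJ_starProjection_mulI (hsep : ∀ x, x ∈ K → x ∈ mulI K → x = 0)
    (hdense : Dense ((K ⊔ mulI K : Submodule ℝ H) : Set H)) (x : H) :
    modJ K hsep hdense ((mulI K).starProjection x) =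
      modJ K hsep hdense x - K.starProjection (modJ K hsep hdense x) := by
  apply modT_injective K hsep hdense
  rw [modT_modJ, modJ_modT, map_sub, ← starProjection_modT, modT_modJ, modJ_modT, modB_apply,
    modB_apply]
  simp only [map_sub, starProjection_starProjection]
  abel

/-- **`J R = (2 − R) J`** (Rieffel–van Daele Prop. 2.2 (5)). [cite: RieffelVandaele1977, Prop. 2.2 (5)] -/
theorem modJ_modR (hsep : ∀ x, x ∈ K → x ∈ mulI K → x = 0)
    (hdense : Dense ((K ⊔ mulI K : Submodule ℝ H) : Set H)) (x : H) :
    modJ K hsep hdense (modR K x) = (2 - modR K) (modJ K hsep hdense x) := by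
  rw [modR_apply, map_add, modJ_starProjection, modJ_starProjection_mulI, sub_apply, two_apply,
    two_smul, modR_apply]
  abel

/-- `J (2 - R) = R J`. [cite: RieffelVandaele1977, Prop. 2.2 (5)] -/
theorem modJ_two_sub_modR (hsep : ∀ x, x ∈ K → x ∈ mulI K → x = 0)
    (hdense : Dense ((K ⊔ mulI K : Submodule ℝ H) : Set H)) (x : H) :
    modJ K hsep hdense ((2 - modR K) x) = modR K (modJ K hsep hdense x) := by
  have h := modJ_modR K hsep hdense (modJ K hsep hdense x)
  rw [modJ_modJ] at h
  rw [← h, modJ_modJ]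

/-- **`J g(R) J = g(2 − R)`** for real continuous `g` (Rieffel–van Daele §3: "from the fact that
`JRJ = 2 − R` it follows easily that `J R^{it} J = (2 − R)^{−it}`"; here the real-function case).
[cite: RieffelVandaele1977, §3 (p. 194)] -/
theorem modJ_cfc_modR (hsep : ∀ x, x ∈ K → x ∈ mulI K → x = 0)
    (hdense : Dense ((K ⊔ mulI K : Submodule ℝ H) : Set H)) {g : ℝ → ℝ} (hg : Continuous g) (x : H) :
    modJ K hsep hdense (cfc g (modR K) x) = cfc g (2 - modR K) (modJ K hsep hdense x) :=
  realCLM_apply_cfc_of_intertwine (antiunitaryToRealCLM (modJ K hsep hdense))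
    (modR_isSelfAdjoint K) (two_sub_modR_isSelfAdjoint K) (modJ_modR K hsep hdense) hg x

/-- `J` commutes with every real continuous function of `T² = R(2 − R)` (in particular with `T`).
[cite: RieffelVandaele1977, Prop. 2.2 (4)] -/
theorem modJ_cfc_modTsq (hsep : ∀ x, x ∈ K → x ∈ mulI K → x = 0)
    (hdense : Dense ((K ⊔ mulI K : Submodule ℝ H) : Set H)) {g : ℝ → ℝ} (hg : Continuous g) (x : H) :
    modJ K hsep hdense (cfc g (modTsq K) x) = cfc g (modTsq K) (modJ K hsep hdense x) := by
  refine realCLM_apply_cfc_comm (antiunitaryToRealCLM (modJ K hsep hdense))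
    (modTsq_isSelfAdjoint K) (fun y => ?_) hg x
  change modJ K hsep hdense (modTsq K y) = modTsq K (modJ K hsep hdense y)
  rw [← modT_mul_modT, mul_apply_eq_comp, mul_apply_eq_comp, modT_modJ, modT_modJ]

end J

end Literature.Analysis.OperatorTheory
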